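import Summits.ResolutionOfSingularities.ResolutionOfSingularities.Theorems.WeightedInvariantHypersurfaceLocalGameEFTDimTwoNewton
import Summits.ResolutionOfSingularities.ResolutionOfSingularities.Theorems.WeightedInvariantHypersurfaceLocalGameEFTDimTwoContact
import HarnessLib

/-!
# The e.f.t. local weighted game (door `HypersurfaceCentreConstruction`): Newton data in two variables — prepared levels, faces, the K6 chain

Topic: `Summits/ResolutionOfSingularities/ResolutionOfSingularities/Theorems`. Helper for the door item
`HypersurfaceCentreConstruction` (statement `stmt-ResolutionOfSingularities-19897`, route `WeightedInvariant`),
line `local-engine` of `res-L1-w43-plan-1` (L W4.3), ORDER (o13) «the `dim S = 2` rung of H2a′» held by res-type-098: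
kernel **K5 «Newton data»**, PART 3 (two variables), on top of PART 1 `…EFTDimTwoSteepening` (the `𝒥_b`-interface,
res-type-078's text) and PART 2 `…EFTDimTwoNewton` (unit monomial expansions in any dimension).  Here `d = 2`,
`u = (x, y)` with `(x, y) = 𝔪`, weights `(1, b)`, `b ≥ 1`, `𝒥_b(n) = weightedMonomialIdeal ![x, y] ![1, b] n`.

* §3 **`prepared_face`** — if `f ≡ c·y^ν (mod 𝒥_b(bν+1))` with `c` a unit («prepared at level `b`»: rational
  `ν`-th-power tangent cone at `b = 1`, the output of PART 1's steepening at higher `b`) then every unit expansion with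
  `N > bν` contains the vertex `(0, ν)` and all its other exponents have `(1,b)`-weight `≥ bν + 1` — the
  «face `= {(0, ν)}`» input of the case-C order computation K3b-iii (res-type-013); **`sub_face_sum_mem_of_expansion`** —
  the level-`b` FACE in PART 1's currency `Σ_{j ≤ ν} a'_j x^{b(ν-j)} y^j` read off the expansion, so that PART 1's
  `face_coeff_mem_maximalIdeal` / `exists_steepen_of_face_eq_pow` and K3a's `rho_transform` see the same face.
* §4 — the exports asked by the assembler (res-type-098, 2026-08-27T07:07:16Z) in PART 1's `𝒥_b`-interface:
  `caseC_or_levelUp` (the (K5e) dichotomy, literally `f ∈ 𝒥_b(bν) ∧ (∃ c unit, f − c·y^ν ∈ 𝒥_b(bν+1)) ∧ f ∉ 𝒥_{b+1}((b+1)ν)`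
  or level-up), `mem_span_pair_of_prepared` (K6's per-step shape `f ∈ (y^ν, x^b)`), and
  **`exists_associated_pow_of_forall_exists_next`** — (K5d)'s chain in K6's hypothesis form: if the D′-event recurs from
  every prepared level then `f = unit·π^ν` (recursion + K6 `LocalGameEFTContact.exists_associated_pow_of_steepening`,
  res-type-078, p505670), i.e. case A of the move table.

[OURS · L1 W4.3] Replaces the role of NO printed item; NOT a statement of the manuscript under review (Hironaka 2017).
AI work, weaker than expert review. Def-free; `--supports stmt-ResolutionOfSingularities-19897 --as helper`.

## References

* J. Włodarczyk, *Functorial resolution by torus actions*, arXiv:2203.03090, Lemma 2.1.12, §3.3. [Wlodarczyk2022]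
* H. Matsumura, *Commutative Ring Theory*, Thm. 16.2, Thm. 8.11, §32. [Matsumura1987]
-/

noncomputable section

open IsLocalRing Literature.AlgebraicGeometry.Resolution

set_option linter.dupNamespace false -- mandated namespace of this single-conjunct summit

namespace Summit.ResolutionOfSingularities.ResolutionOfSingularities.Theorems

namespace LocalGameEFTNewton

universe u

variable {S : Type u} [CommRing S]

/-! ### §3 Two variables, weights `(1, b)`: prepared levels and faces read on an expansion -/

section TwoVariables

variable [IsRegularLocalRing S]

/-- **Prepared at level `b` ⇒ the face is the vertex `(0, ν)` alone.**  In a two-dimensional regular local ring with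
`(x, y) = 𝔪` and `b ≥ 1`: if `f ≡ c·y^ν (mod 𝒥_b(bν+1))` with `c` a unit, then every unit expansion
`f = Σ_{α ∈ Δ} a_α x^{α₀} y^{α₁} + r`, `r ∈ 𝔪^N`, `N > bν`, contains the exponent `(0, ν)`, and all its other exponents
have `(1, b)`-weight `α₀ + b·α₁ ≥ bν + 1` (so `α₀ > b(ν - α₁)` whenever `α₁ < ν`: the first Newton slope exceeds `b`).
This is the «face `= {(0, ν)}`» hypothesis of the case-C order computation (K3b-iii). [cite: Matsumura1987, Thm. 16.2] -/
theorem prepared_face (hdim : ringKrullDim S = (2 : ℕ)) {x y : S} (hxy : Ideal.span {x, y} = maximalIdeal S)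
    {b : ℕ} (hb : 1 ≤ b) {ν : ℕ} {f c : S} (hc : IsUnit c)
    (hprep : f - c * y ^ ν ∈ weightedMonomialIdeal ![x, y] ![1, b] (b * ν + 1))
    {Δ : Finset (Fin 2 → ℕ)} {a : (Fin 2 → ℕ) → S} {N : ℕ} (hunit : ∀ α ∈ Δ, IsUnit (a α))
    (hr : f - ∑ α ∈ Δ, a α * ∏ i, ![x, y] i ^ α i ∈ maximalIdeal S ^ N) (hN : b * ν + 1 ≤ N) :
    (![0, ν] : Fin 2 → ℕ) ∈ Δ ∧ ∀ α ∈ Δ, α ≠ ![0, ν] → b * ν + 1 ≤ α 0 + b * α 1 := by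
  classical
  have hu := span_range_vecCons_eq hxy
  have hw : ∀ i, 0 < (![1, b] : Fin 2 → ℕ) i := Fin.forall_fin_two.2 ⟨one_pos, hb⟩
  -- `f ∈ 𝒥_b(bν)`, so all weights are `≥ bν`
  have hyν : c * y ^ ν ∈ weightedMonomialIdeal ![x, y] ![1, b] (b * ν) := by
    refine Ideal.mul_mem_left _ _ ?_
    have h := pow_mem_weightedMonomialIdeal ![x, y] ![1, b] (LocalGameEFTSteepening.snd_mem x y b) ν
    exact h
  have hfJ : f ∈ weightedMonomialIdeal ![x, y] ![1, b] (b * ν) := by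
    have := Ideal.add_mem _ (weightedMonomialIdeal_antitone _ _ (Nat.le_succ _) hprep) hyν
    rwa [sub_add_cancel] at this
  have hge : ∀ α ∈ Δ, b * ν ≤ ∑ i, ![1, b] i * α i :=
    le_weight_of_mem_weightedMonomialIdeal ![x, y] hu hdim ![1, b] hw hunit hr hfJ (by omega)
  -- the weight-`bν` layer against `Q = c·Y^ν`
  set e : Fin 2 →₀ ℕ := Finsupp.equivFunOnFinite.symm ![0, ν] with he
  have hQ : (MvPolynomial.monomial e c).IsWeightedHomogeneous ![1, b] (b * ν) :=
    MvPolynomial.isWeightedHomogeneous_monomial _ e c (by rw [he, weight_equivFunOnFinite_symm ![1, b], weight_two]; simp)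
  have hfQ : f - MvPolynomial.eval ![x, y] (MvPolynomial.monomial e c) ∈
      weightedMonomialIdeal ![x, y] ![1, b] (b * ν + 1) := by
    rw [he, eval_monomial_equivFunOnFinite_symm ![x, y], prod_two]
    simpa using hprep
  have hlayer := coeff_layer_sub_mem_maximalIdeal ![x, y] hu hdim ![1, b] hw hr hge (by omega) _ hQ hfQ
  -- coefficient at an exponent `α ≠ (0, ν)` of weight `bν`: it is the unit `a α`
  have hcoeffP : ∀ α₀ : Fin 2 → ℕ, (∑ α ∈ Δ.filter (fun α => ∑ i, ![1, b] i * α i = b * ν),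
      MvPolynomial.monomial (Finsupp.equivFunOnFinite.symm α) (a α)).coeff (Finsupp.equivFunOnFinite.symm α₀) =
        if α₀ ∈ Δ.filter (fun α => ∑ i, ![1, b] i * α i = b * ν) then a α₀ else 0 := by
    intro α₀
    rw [MvPolynomial.coeff_sum]
    split_ifs with h
    · rw [Finset.sum_eq_single α₀ (fun α' _ hne => by
          rw [MvPolynomial.coeff_monomial, if_neg]
          exact fun h' => hne (Finsupp.equivFunOnFinite.symm.injective h')) (fun h' => absurd h h'),
        MvPolynomial.coeff_monomial, if_pos rfl]
    · refine Finset.sum_eq_zero fun α' hα' => ?_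
      rw [MvPolynomial.coeff_monomial, if_neg]
      rintro h'
      exact h ((Finsupp.equivFunOnFinite.symm.injective h') ▸ hα')
  constructor
  · by_contra hnot
    have h := hlayer e
    rw [MvPolynomial.coeff_sub, he, hcoeffP, if_neg (fun h' => hnot (Finset.mem_filter.mp h').1),
      MvPolynomial.coeff_monomial, if_pos rfl, zero_sub] at h
    exact (mem_maximalIdeal _).mp ((maximalIdeal S).neg_mem_iff.mp h) hc
  · intro α hα hne
    have hwt := hge α hα
    rw [weight_two] at hwt
    by_contra hlt
    have heq : α 0 + b * α 1 = b * ν := by omega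
    have h := hlayer (Finsupp.equivFunOnFinite.symm α)
    rw [MvPolynomial.coeff_sub, hcoeffP, if_pos (Finset.mem_filter.mpr ⟨hα, by rw [weight_two, heq]⟩),
      MvPolynomial.coeff_monomial, if_neg (fun h' => hne (Finsupp.equivFunOnFinite.symm.injective h').symm),
      sub_zero] at h
    exact (mem_maximalIdeal _).mp h (hunit α hα)

/-- **The level-`b` face read on an expansion.**  If all exponents of `f = Σ_Δ a_α x^{α₀} y^{α₁} + r` (`r ∈ 𝔪^N`,
`N > bν`, `b ≥ 1`) have `(1, b)`-weight `≥ bν`, then modulo `𝒥_b(bν+1)` `f` is its FACE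
`Σ_{j ≤ ν} a'_j x^{b(ν-j)} y^j` with `a'_j := a_{(b(ν-j), j)}` when that exponent lies in `Δ` and `0` otherwise — the
currency of PART 1 (`LocalGameEFTSteepening.exists_face`, `face_coeff_mem_maximalIdeal`,
`exists_steepen_of_face_eq_pow`). [cite: Wlodarczyk2022, Lemma 2.1.12] -/
theorem sub_face_sum_mem_of_expansion {x y : S} (hxy : Ideal.span {x, y} = maximalIdeal S) {b : ℕ} (hb : 1 ≤ b)
    {ν : ℕ} {f : S} {Δ : Finset (Fin 2 → ℕ)} {a : (Fin 2 → ℕ) → S} {N : ℕ}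
    (hr : f - ∑ α ∈ Δ, a α * ∏ i, ![x, y] i ^ α i ∈ maximalIdeal S ^ N) (hN : b * ν + 1 ≤ N)
    (hge : ∀ α ∈ Δ, b * ν ≤ α 0 + b * α 1) :
    f - ∑ j ∈ Finset.range (ν + 1),
        (if (![b * (ν - j), j] : Fin 2 → ℕ) ∈ Δ then a ![b * (ν - j), j] else 0) * (x ^ (b * (ν - j)) * y ^ j) ∈
      weightedMonomialIdeal ![x, y] ![1, b] (b * ν + 1) := by
  classical
  have hu := span_range_vecCons_eq hxy
  have hw : ∀ i, 0 < (![1, b] : Fin 2 → ℕ) i := Fin.forall_fin_two.2 ⟨one_pos, hb⟩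
  have hJ : maximalIdeal S ^ N ≤ weightedMonomialIdeal ![x, y] ![1, b] (b * ν + 1) :=
    (Ideal.pow_le_pow_right hN).trans (pow_le_weightedMonomialIdeal_of_span_eq _ _ hw hu _)
  -- split `Δ` into the face and the rest
  set F := Δ.filter (fun α => α 0 + b * α 1 = b * ν) with hF
  have hhigh : ∑ α ∈ Δ.filter (fun α => ¬ α 0 + b * α 1 = b * ν), a α * ∏ i, ![x, y] i ^ α i ∈
      weightedMonomialIdeal ![x, y] ![1, b] (b * ν + 1) := by
    refine Ideal.sum_mem _ fun α hα => Ideal.mul_mem_left _ _ ?_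
    obtain ⟨hαΔ, hne⟩ := Finset.mem_filter.mp hα
    exact prod_pow_mem_weightedMonomialIdeal _ _ α (by rw [weight_two]; have := hge α hαΔ; omega)
  -- the face sum, re-indexed by `j = α₁`
  have hface : ∑ j ∈ Finset.range (ν + 1),
      (if (![b * (ν - j), j] : Fin 2 → ℕ) ∈ Δ then a ![b * (ν - j), j] else 0) * (x ^ (b * (ν - j)) * y ^ j) =
        ∑ α ∈ F, a α * ∏ i, ![x, y] i ^ α i := by
    -- drop the vanishing terms, then re-index
    rw [← Finset.sum_filter_of_ne (p := fun j => (![b * (ν - j), j] : Fin 2 → ℕ) ∈ Δ)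
      (fun j _ hj => by by_contra h; exact hj (by rw [if_neg h, zero_mul]))]
    refine Finset.sum_bij (fun j _ => (![b * (ν - j), j] : Fin 2 → ℕ)) ?_ ?_ ?_ ?_
    · intro j hj
      obtain ⟨hjr, hjΔ⟩ := Finset.mem_filter.mp hj
      refine Finset.mem_filter.mpr ⟨hjΔ, ?_⟩
      have hjν : j ≤ ν := Nat.lt_succ_iff.mp (Finset.mem_range.mp hjr)
      simp only [Matrix.cons_val_zero, Matrix.cons_val_one]
      rw [Nat.mul_sub, Nat.sub_add_cancel (Nat.mul_le_mul_left b hjν)]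
    · intro j₁ hj₁ j₂ hj₂ h
      have := congrFun h 1
      simpa using this
    · intro α hα
      obtain ⟨hαΔ, hαeq⟩ := Finset.mem_filter.mp hα
      have hα1 : α 1 ≤ ν := by
        by_contra hlt
        have : b * (ν + 1) ≤ b * α 1 := Nat.mul_le_mul_left b (by omega)
        rw [Nat.mul_succ] at this
        omega
      have hα0 : α 0 = b * (ν - α 1) := by rw [Nat.mul_sub]; omega
      have hαvec : (![b * (ν - α 1), α 1] : Fin 2 → ℕ) = α := by
        ext i; fin_cases i <;> simp [hα0]
      refine ⟨α 1, Finset.mem_filter.mpr ⟨Finset.mem_range.mpr (Nat.lt_succ_of_le hα1), by rw [hαvec]; exact hαΔ⟩,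
        hαvec⟩
    · intro j hj
      obtain ⟨-, hjΔ⟩ := Finset.mem_filter.mp hj
      rw [if_pos hjΔ, prod_two]
      simp
  rw [hface]
  have hsplit : ∑ α ∈ Δ, a α * ∏ i, ![x, y] i ^ α i =
      ∑ α ∈ F, a α * ∏ i, ![x, y] i ^ α i +
        ∑ α ∈ Δ.filter (fun α => ¬ α 0 + b * α 1 = b * ν), a α * ∏ i, ![x, y] i ^ α i :=
    (Finset.sum_filter_add_sum_filter_not Δ _ _).symm
  have hkey : f - ∑ α ∈ F, a α * ∏ i, ![x, y] i ^ α i =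
      (f - ∑ α ∈ Δ, a α * ∏ i, ![x, y] i ^ α i) +
        ∑ α ∈ Δ.filter (fun α => ¬ α 0 + b * α 1 = b * ν), a α * ∏ i, ![x, y] i ^ α i := by
    rw [hsplit]; ring
  rw [hkey]
  exact Ideal.add_mem _ (hJ hr) hhigh

end TwoVariables

/-! ### §4 The exports asked by the assembler (res-type-098, 2026-08-27T07:07:16Z) in the `𝒥_b`-interface of PART 1 -/

section Exports

/-- **(K5e) level-up dichotomy, literal export.**  After PART 1's steepening at level `b` (`f ≡ c·y^ν (mod 𝒥_b(bν+1))`,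
`c` a unit, in the steepened coordinates), EITHER `f ∈ 𝒥_{b+1}((b+1)ν)` (next D/D′ test at level `b + 1`) OR the
CASE-C datum `f ∈ 𝒥_b(bν) ∧ (∃ c unit, f − c·y^ν ∈ 𝒥_b(bν+1)) ∧ f ∉ 𝒥_{b+1}((b+1)ν)` (`⌊β*⌋ = b`, kernel K3).
Plain logic over PART 1's `snd_mem`. [folklore] -/
theorem caseC_or_levelUp {x y f c : S} {b ν : ℕ} (hc : IsUnit c)
    (hprep : f - c * y ^ ν ∈ weightedMonomialIdeal ![x, y] ![1, b] (b * ν + 1)) :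
    (f ∈ weightedMonomialIdeal ![x, y] ![1, b] (b * ν) ∧
        (∃ c : S, IsUnit c ∧ f - c * y ^ ν ∈ weightedMonomialIdeal ![x, y] ![1, b] (b * ν + 1)) ∧
        f ∉ weightedMonomialIdeal ![x, y] ![1, b + 1] ((b + 1) * ν)) ∨
      f ∈ weightedMonomialIdeal ![x, y] ![1, b + 1] ((b + 1) * ν) := by
  by_cases hup : f ∈ weightedMonomialIdeal ![x, y] ![1, b + 1] ((b + 1) * ν)
  · exact Or.inr hup
  · refine Or.inl ⟨?_, ⟨c, hc, hprep⟩, hup⟩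
    have hyν : c * y ^ ν ∈ weightedMonomialIdeal ![x, y] ![1, b] (b * ν) :=
      Ideal.mul_mem_left _ _ (pow_mem_weightedMonomialIdeal ![x, y] ![1, b] (LocalGameEFTSteepening.snd_mem x y b) ν)
    have := Ideal.add_mem _ (weightedMonomialIdeal_antitone _ _ (Nat.le_succ _) hprep) hyν
    rwa [sub_add_cancel] at this

/-- **A prepared level feeds K6's per-step hypothesis**: `f ≡ c·y^ν (mod 𝒥_b(bν+1))` gives `f ∈ (y^ν, x^b)`
(PART 1's `weightedMonomialIdeal_le_span_pair`). [folklore] -/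
theorem mem_span_pair_of_prepared {x y f c : S} {b ν : ℕ}
    (hprep : f - c * y ^ ν ∈ weightedMonomialIdeal ![x, y] ![1, b] (b * ν + 1)) :
    f ∈ Ideal.span {y ^ ν, x ^ b} := by
  have hyν : c * y ^ ν ∈ Ideal.span ({y ^ ν, x ^ b} : Set S) :=
    Ideal.mul_mem_left _ _ (Ideal.subset_span (by simp))
  have hf : f - c * y ^ ν ∈ Ideal.span ({y ^ ν, x ^ b} : Set S) :=
    LocalGameEFTSteepening.weightedMonomialIdeal_le_span_pair x y b ν
      (weightedMonomialIdeal_antitone _ _ (Nat.le_succ _) hprep)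
  have := Ideal.add_mem _ hf hyν
  rwa [sub_add_cancel] at this

variable [IsRegularLocalRing S]

/-- **(K5d)'s chain in K6's hypothesis form: an endless run of steepenings forces `f = unit · π^ν`.**  Let `P b y` be any
«prepared at level `b` in the coordinate `y`» predicate (the assembler's: `(x, y) = 𝔪` and `f ≡ unit·y^ν (mod 𝒥_b(bν+1))`)
such that `P b y` gives `y ∈ 𝔪 ∖ 𝔪²` and `f ∈ (y^ν, x^b)` (`mem_span_pair_of_prepared`, PART 1's
`not_mem_sq_of_span_pair_eq`), and suppose the D′-event ALWAYS recurs: from every prepared `(b, y)` one reaches a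
prepared `(b', y')` at a higher level with `y' − y ∈ (x^b)` (PART 1's `exists_steepen_of_face_eq_pow` +
`span_pair_steepen_eq`).  Then, in an excellent regular local ring (`IsExcellentRing.of_essFiniteType` at the game's
positions), `f` is a unit times the `ν`-th power of a regular parameter: the recursion builds the sequence
`(b_k, y_k)` and K6 `LocalGameEFTContact.exists_associated_pow_of_steepening` (res-type-078, p505670) concludes — so
case A of the move table applies and the D′-loop terminates. [OURS · L1 W4.3 · (o13) K5→K6 glue]
[cite: Matsumura1987, Thm. 8.11, §32] -/
theorem exists_associated_pow_of_forall_exists_next (hS : IsExcellentRing S) {x : S} (hx : x ∈ maximalIdeal S)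
    {f : S} {ν : ℕ} (hν : 1 ≤ ν) (hford : f ∉ maximalIdeal S ^ (ν + 1)) (P : ℕ → S → Prop)
    (hP : ∀ b y, P b y → y ∈ maximalIdeal S ∧ y ∉ maximalIdeal S ^ 2 ∧ f ∈ Ideal.span {y ^ ν, x ^ b})
    (hnext : ∀ b y, P b y → ∃ b' y', b < b' ∧ P b' y' ∧ y' - y ∈ Ideal.span {x ^ b})
    {b₀ : ℕ} {y₀ : S} (h₀ : P b₀ y₀) :
    ∃ π : S, π ∈ maximalIdeal S ∧ π ∉ maximalIdeal S ^ 2 ∧ Associated f (π ^ ν) := by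
  classical
  -- the sequence of prepared levels
  let step : {q : ℕ × S // P q.1 q.2} → {q : ℕ × S // P q.1 q.2} := fun q =>
    ⟨((hnext q.1.1 q.1.2 q.2).choose, (hnext q.1.1 q.1.2 q.2).choose_spec.choose),
      (hnext q.1.1 q.1.2 q.2).choose_spec.choose_spec.2.1⟩
  let seq : ℕ → {q : ℕ × S // P q.1 q.2} := fun k => step^[k] ⟨(b₀, y₀), h₀⟩
  have hseq_succ : ∀ k, seq (k + 1) = step (seq k) := fun k => Function.iterate_succ_apply' step k _
  have hlt : ∀ k, (seq k).1.1 < (seq (k + 1)).1.1 := fun k => by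
    rw [hseq_succ]
    exact (hnext (seq k).1.1 (seq k).1.2 (seq k).2).choose_spec.choose_spec.1
  have hsub : ∀ k, (seq (k + 1)).1.2 - (seq k).1.2 ∈ Ideal.span {x ^ (seq k).1.1} := fun k => by
    rw [hseq_succ]
    exact (hnext (seq k).1.1 (seq k).1.2 (seq k).2).choose_spec.choose_spec.2.2
  refine LocalGameEFTContact.exists_associated_pow_of_steepening hS hx (fun k => (seq k).1.2)
    (fun k => (hP _ _ (seq k).2).1) (fun k => (hP _ _ (seq k).2).2.1) (b := fun k => (seq k).1.1)
    (strictMono_nat_of_lt_succ hlt) hsub hν hford (fun k => (hP _ _ (seq k).2).2.2)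

end Exports

end LocalGameEFTNewton

end Summit.ResolutionOfSingularities.ResolutionOfSingularities.Theorems

end
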